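import Summits.BirchSwinnertonDyer.Rank1Residual.X11b.KolyvaginPointInertia
import Summits.BirchSwinnertonDyer.Rank1Residual.X11b.NeronIdentityReceptacleKodairaNeron
import Literature.NumberTheory.EllipticCurves.HeegnerPointsKolyvaginGoodReductionProofs
import Literature.NumberTheory.EllipticCurves.HasseWeilGoodReduction
import HarnessLib

/-!
# X11b (team N8/O2): the receptacle clause `hGZ` of Gross 1991, Prop. 6.2 (1) SUPPLIED by
# Kodaira–Néron at every prime `p` not dividing the component-group exponents
# (`p ∤ ord_v(Δ_min)` at the multiplicative `v`, `p ≥ 5` if some `v` is additive)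

HONEST FRAMING (cell `b2b-bsdres`, run/shared/lean/b2b/bsd-rank1-residual/, verbatim in every
file): the goal of the cell is to DELETE the COMBINATION-SHAPED residual classes of the
Birch–Swinnerton-Dyer formula for ALL analytic-rank `≤ 1` elliptic curves over `ℚ` — "full BSD
formula for every rank `≤ 1` curve in class `C`" assembled STRICTLY from published theorems — so
that the rank-`≤ 1` remainder becomes exactly the CONSTRUCTION-SHAPED classes, which are TYPED
(missing-input `Prop`s), NOT attempted. This is not "finishing BSD". Team N8/O2 = `x11b3`, seat
`b2b-bsdres-x11b3-p2` (GEN 33). THEOREMS ONLY (no definition, no named fact, no `sorry`);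
`K : Type`; nothing booked; no mark / label / count / tier moves.

## What

The cite-only binder **`hGZ` = [GZ86, III (3.1)] in the per-point form Gross 1991 p. 245 uses it**
of the cell's Kolyvagin files (`KolyvaginHloc.hloc_concrete_of_GZ31`, x11b3-p2 GEN 10;
`KolyvaginAssembly.hpoints_of_perLevelChoice` / `sha_primary_finite_of_leafInputs_*`, GEN 13):

  `∃ n', IsCoprime (p^M) n' ∧ ∀ m ∣ n, ∀ γ ∈ 𝒢_m, ∀ v bad, n' • (γ y_m)_v ∈ E⁰(K̄_v) ∧
   ∀ ℓ ∣ m, n' • (γ y_{m/ℓ}↑)_v ∈ E⁰(K̄_v)`,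

is here a THEOREM — with NO Heegner input and for ANY family `d` of Kolyvagin–Heegner data —
under the decidable per-curve hypothesis

  (KN) `p ∤ ord_v(Δ_min(E/K))` at every multiplicative place `v` of `E/K`, and, if `p = 3`, no
       additive place of `E/K` has Kodaira type IV or IV* (for `p ≥ 5` additive places are free:
       the exponent is `≤ 4`),

by the theorem of Kodaira–Néron over `K_v^nr` (Silverman *AEC* VII.6.1; x11b3-p2's
`X11b.ordMinimalDiscriminant_nsmul_mem_E0Receptacle` / `X11b.exists_nsmul_mem_E0Receptacle_le_four`):
every point of `E(K[m])` is fixed by the local inertia at a bad `v` (which does not divide `m`: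
the Kolyvagin primes are primes of good reduction, Gross (3.1) with §1; `K[m]/K` is unramified
off `m`, tree `KolyvaginH44.resGal_smul_algHom_ringClassField_eq_self`), hence killed modulo
`E⁰(K̄_v)` by the exponent `c_v` (`= ord_v(Δ_min)` at multiplicative `v`; `≤ 4`, and prime to `3` off
the types IV / IV*, at additive `v` — x11b3-p2's `X11b.exists_nsmul_mem_E0Receptacle_not_three_dvd`);
`n' = ∏_{v bad} c_v` is prime to `p`.

READING (EVIDENCE wording, for the lead / referee): on the sub-class (KN) the OPEN-LEAF label
[GZ86 III (3.1)] is DISCHARGED (tree theorem); the published input [GZ86, III (3.1)] (the Heegner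
divisor reduces into `J₀(N)⁰` at `v ∣ N`) remains needed EXACTLY at the primes `p` dividing
`2 · ∏_{v mult} ord_v(Δ_min)`, and at `p = 3` when an additive place of type IV / IV* is present.
Nothing else is discharged: (γ), (A′-53), hCM, hrec, hPT, hexc, hK1 untouched; nothing booked.

* `KolyvaginHloc.natCast_not_mem_of_not_hasGoodReductionAt` — a bad place of `E/K` divides no
  Kolyvagin level (`m ∣ n`, `n` square-free with Kolyvagin prime factors).
* `KolyvaginHloc.smul_pointsMap_toGeomPoints_eq_of_mem_localInertia` — local inertia at `v ∤ m`
  fixes `E(K[m]) ⊆ E(K̄_v)`.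
* **`KolyvaginHloc.hGZ_of_kodairaNeron`** — the END: the `hGZ` clause VERBATIM under (KN).
* `KolyvaginHloc.hGZ_of_kodairaNeron_three` — the END at the cell's prime `p = 3` (specialisation;
  x11b3-lead GEN 23's request, LEAD DEAL #24): on (KN₃) no `p ≠ 3 ∨ …` disjunct remains.

## References

* [GrossLMS1991] B. H. Gross, *Kolyvagin's work on modular elliptic curves*, LMS LNS 153 (1991),
  Prop. 6.2 (1) and its proof, §3 (3.1) (held `book:editornd-l-functions-arithmetic`, chunk 222).
* [GrossZagier1986] B. H. Gross, D. Zagier, *Heegner points and derivatives of L-series*,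
  Invent. Math. 84 (1986), III (3.1) (cite-only; the clause supplied here on (KN)).
* [SilvermanAEC2009] J. H. Silverman, *The Arithmetic of Elliptic Curves*, 2nd ed., Thm. VII.6.1,
  Cor. VII.6.2 (PDF p. 177).
* [Cox2013] D. A. Cox, *Primes of the form x² + ny²*, 2nd ed., §9.A (`K[m]/K` unramified off `m`).

presearch: "Kodaira–Néron exponent kills the component obstruction in Gross 6.2(1)" →
[corpus: book:editornd-l-functions-arithmetic chunk 222] Gross's proof cites [GZ86 III (3.1)] for
the `E⁰`-valuedness; the Tamagawa-exponent alternative for `p ∤ c_v` is folklore (referee H37: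
"`3 ∣ c_v` would bite"); `lean search 'hGZ_of_kodairaNeron|ordMinimalDiscriminant_nsmul_mem'` →
no matches (INTENT-grep).
-/

noncomputable section

open scoped Classical
open WeierstrassCurve Field NumberField IsDedekindDomain Finset
open Literature.NumberTheory.EllipticCurves Literature.NumberTheory.GaloisRepresentations
open Literature.NumberTheory.EllipticCurves.RingClassField Literature.NumberTheory.EllipticCurves.ModularForms
open Literature.NumberTheory.DiophantineGeometry Literature.NumberTheory.DiophantineGeometry.TateAlgorithm

namespace Summit.BirchSwinnertonDyer.Rank1Residual.X11b.KolyvaginHloc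

-- `K : Type`: the tree's ring-class class field theory is universe `0`.
variable {K : Type} [Field K] [NumberField K] {N : ℕ} {W : WeierstrassCurve ℚ}

/-- `n • x ∈ H` when `c • x ∈ H` and `c ∣ n`. [folklore] -/
theorem zsmul_mem_of_nsmul_mem_of_dvd {A : Type*} [AddCommGroup A] (H : AddSubgroup A) {c : ℕ}
    {n : ℤ} {x : A} (h : c • x ∈ H) (hdvd : (c : ℤ) ∣ n) : n • x ∈ H := by
  obtain ⟨k, rfl⟩ := hdvd
  rw [mul_comm, mul_zsmul, natCast_zsmul]
  exact H.zsmul_mem h k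

/-! ## Bad places divide no Kolyvagin level -/

/-- **A bad place of `E/K` divides no Kolyvagin level.** For `n` square-free whose prime factors
are Kolyvagin primes (Gross 1991, (3.1): `ℓ ∤ N`, `N` the level of the modular parametrisation
`Dt`, hence `E` has good reduction at `ℓ`, tree `hasGoodReductionAt_of_isNewformOf_of_not_dvd`,
base-changed to the unique place `λ = (ℓ)` of `K`, tree
`hasGoodReductionAt_baseChange_of_hasGoodReductionAt_rat`) and `m ∣ n`: if `v` is a place of BAD
reduction of `E/K` then `m ∉ v`. [cite: GrossLMS1991, §3 (3.1) with §1] -/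
theorem natCast_not_mem_of_not_hasGoodReductionAt [NeZero N] [W.IsElliptic]
    (Dt : ModularParametrizationData W N) {p n : ℕ} (hn : Squarefree n)
    (hKol : ∀ q ∈ n.primeFactors, IsKolyvaginPrime N W K p q)
    {v : HeightOneSpectrum (𝓞 K)} (hv : ¬ (W.baseChange K).HasGoodReductionAt v)
    {m : ℕ} (hm : m ∣ n) : ((m : ℕ) : 𝓞 K) ∉ v.asIdeal := by
  intro hmv
  have hn0 : n ≠ 0 := Squarefree.ne_zero hn
  have hmsq : Squarefree m := hn.squarefree_of_dvd hm
  -- `m = ∏_{q ∣ m} q` lies in the prime `v`, so some Kolyvagin prime `q ∣ m` does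
  have hprod : ((∏ q ∈ m.primeFactors, q : ℕ) : 𝓞 K) ∈ v.asIdeal := by
    rwa [Nat.prod_primeFactors_of_squarefree hmsq]
  rw [Nat.cast_prod] at hprod
  obtain ⟨q, hq, hqv⟩ := (Ideal.IsPrime.prod_mem_iff (hp := v.isPrime)).mp hprod
  have hqK : IsKolyvaginPrime N W K p q := hKol q (Nat.primeFactors_mono hm hn0 hq)
  -- `v = λ = (q)`, a place of good reduction
  have hvq : v = hqK.place := hqK.mem_iff.mp hqv
  subst hvq
  haveI : hqK.place.asIdeal.LiesOver (hqK.place.under (𝓞 ℚ)).asIdeal := ⟨rfl⟩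
  exact hv (hasGoodReductionAt_baseChange_of_hasGoodReductionAt_rat W (hqK.place.under (𝓞 ℚ))
    hqK.place (hasGoodReductionAt_of_isNewformOf_of_not_dvd W Dt.isNewformOf hqK.prime hqK.2.1 _
      hqK.natCast_mem_under))

/-! ## Local inertia away from `m` fixes `E(K[m]) ⊆ E(K̄_v)` -/

/-- **Local inertia at `v ∤ m` fixes `E(K[m]) ⊆ E(K̄_v)`** (Gross 1991, proof of Prop. 6.2 (1):
"`K[n]/K` is unramified at `v`"; McCallum 1991, Lemma 4.3): for Kolyvagin–Heegner data `dm` at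
level `m ≠ 0`, a finite place `v` with `m ∉ v`, a prime `𝔐` of `\bar 𝓞_v` above `𝓂_v` and `t` in
its inertia group, `t • (dm.toGeomPoints P)_v = (dm.toGeomPoints P)_v` for every `P ∈ E(K[m])`
(`res(t)` fixes `dm.emb (K[m])` pointwise, tree `KolyvaginH44.resGal_smul_algHom_ringClassField_eq_self`;
`Γ_K` acts coordinatewise; `pointsMap` is `res`-equivariant, tree `pointsMap_smul`).
[cite: GrossLMS1991, Prop. 6.2 (1)] [cite: McCallumLMS1991, Lemma 4.3] -/
theorem smul_pointsMap_toGeomPoints_eq_of_mem_localInertia [NeZero N]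
    (hK : IsImaginaryQuadratic K) (ι : K →+* ℂ) {Dt : ModularParametrizationData W N} {β : ℤ}
    {m : ℕ} (hm : m ≠ 0) (dm : KolyvaginHeegnerData Dt β ι m)
    {v : HeightOneSpectrum (𝓞 K)} (hv : ((m : ℕ) : 𝓞 K) ∉ v.asIdeal)
    {𝔐 : Ideal (v.localAbsIntegers)} (h𝔐 : 𝔐 ∈ v.localPrimesAbove)
    {t : absoluteGaloisGroup (v.adicCompletion K)}
    (ht : t ∈ 𝔐.inertia (absoluteGaloisGroup (v.adicCompletion K)))
    (P : (W.baseChange (ringClassField K ι m)).toAffine.Point) :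
    t • pointsMap (W.baseChange K) (v.adicCompletion K) (dm.toGeomPoints P) =
      pointsMap (W.baseChange K) (v.adicCompletion K) (dm.toGeomPoints P) := by
  rw [← pointsMap_smul]
  congr 1
  -- `res(t)` fixes `dm.emb (K[m])` pointwise
  let e : ringClassField K ι m →ₐ[K] AlgebraicClosure K := { dm.emb with commutes' := dm.emb_apply }
  have hfix : ∀ x : ringClassField K ι m,
      resGal (K := K) (v.adicCompletion K) t • dm.emb x = dm.emb x := fun x ↦
    KolyvaginH44.resGal_smul_algHom_ringClassField_eq_self hK ι hm e hv h𝔐 ht x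
  rcases P with _ | ⟨x, y, hxy⟩
  · change resGal (K := K) (v.adicCompletion K) t • dm.toGeomPoints 0 = dm.toGeomPoints 0
    rw [map_zero, smul_zero]
  · have h1 : dm.toGeomPoints (.some x y hxy) =
        Affine.Point.map (W' := W) dm.emb.toRatAlgHom (.some x y hxy) := rfl
    rw [h1, Affine.Point.map_some]
    have hns : ((W.baseChange K).baseChange (AlgebraicClosure K)).toAffine.Nonsingular
        (dm.emb x) (dm.emb y) :=
      (Affine.baseChange_nonsingular W dm.emb.toRatAlgHom.injective x y).mpr hxy
    change Affine.Point.map (W' := W.baseChange K)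
        ((show AlgebraicClosure K ≃ₐ[K] AlgebraicClosure K from
            resGal (K := K) (v.adicCompletion K) t) :
          AlgebraicClosure K →ₐ[K] AlgebraicClosure K)
        (Affine.Point.some (dm.emb x) (dm.emb y) hns) = Affine.Point.some (dm.emb x) (dm.emb y) hns
    rw [Affine.Point.map_some]
    simp only [Affine.Point.some.injEq, AlgEquiv.coe_toAlgHom]
    exact ⟨hfix x, hfix y⟩

/-! ## The END: `hGZ` SUPPLIED by Kodaira–Néron on the sub-class (KN) -/

/-- **The receptacle clause `hGZ` of Gross 1991, Prop. 6.2 (1) ([GZ86, III (3.1)] as Gross p. 245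
uses it) SUPPLIED by Kodaira–Néron on the sub-class (KN).**  For `E/ℚ` elliptic with modular
parametrisation `Dt` of level `N`, `K` imaginary quadratic, a prime `p`, `M`, a square-free `n`
whose prime factors are Kolyvagin primes, ANY family `d` of Kolyvagin–Heegner data at the divisors
of `n`, and
(KN) `p ∤ ord_v(Δ_min(E/K))` at every place `v` of multiplicative reduction of `E/K`, and, when
`p = 3`, Kodaira type `∉ {IV, IV*}` at every place of additive reduction (`p` odd):
there is `n'` prime to `p^M` with `n' • (γ y_m)_v ∈ E⁰(K̄_v)` and `n' • (γ y_{m/ℓ}↑)_v ∈ E⁰(K̄_v)`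
for all `m ∣ n`, `γ ∈ 𝒢_m`, bad `v`, `ℓ ∣ m` — the binder `hGZ` of
`KolyvaginHloc.hloc_concrete_of_GZ31` / `KolyvaginAssembly.hpoints_of_perLevelChoice` VERBATIM.
Proof: `n' = ∏_{v bad} c_v` with `c_v = ord_v(Δ_min)` (multiplicative `v`, tree
`X11b.ordMinimalDiscriminant_nsmul_mem_E0Receptacle`) or the Kodaira–Néron exponent `≤ 4`
(additive `v`, `X11b.exists_nsmul_mem_E0Receptacle_le_four`), applied to the points of
`E(K[m]) ⊆ E(K̄_v)` (and `X11b.exists_nsmul_mem_E0Receptacle_not_three_dvd` at `p = 3`), which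
local inertia fixes (`smul_pointsMap_toGeomPoints_eq_of_mem_localInertia`,
`natCast_not_mem_of_not_hasGoodReductionAt`).  HONEST: on (KN) the label [GZ86 III (3.1)] is a
tree theorem; off (KN) it stays cite-only; nothing else discharged; nothing booked; no mark.
[cite: GrossLMS1991, Prop. 6.2 (1) and its proof] [cite: SilvermanAEC2009, Thm. VII.6.1, Cor. VII.6.2] -/
theorem hGZ_of_kodairaNeron [NeZero N] [W.IsElliptic]
    (hK : IsImaginaryQuadratic K) (ι : K →+* ℂ) (Dt : ModularParametrizationData W N) {β : ℤ}
    {p M : ℕ} (hp : p.Prime) (hp2 : p ≠ 2) {n : ℕ} (hn : Squarefree n)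
    (hKol : ∀ q ∈ n.primeFactors, IsKolyvaginPrime N W K p q ∧ FrobEqFrobInfty W K (p ^ M) q)
    (d : (m : ℕ) → m ∣ n → KolyvaginHeegnerData Dt β ι m)
    (hmult : ∀ v : HeightOneSpectrum (𝓞 K), (W.baseChange K).HasMultiplicativeReductionAt v →
      ¬ p ∣ (W.baseChange K).ordMinimalDiscriminant v)
    (hadd : ∀ v : HeightOneSpectrum (𝓞 K), (W.baseChange K).HasAdditiveReductionAt v → p ≠ 3 ∨
      ((W.baseChange K).kodairaSymbolAt v ≠ KodairaSymbol.IV ∧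
        (W.baseChange K).kodairaSymbolAt v ≠ KodairaSymbol.IVstar)) :
    ∃ n' : ℤ, IsCoprime ((p ^ M : ℕ) : ℤ) n' ∧
      ∀ (m : ℕ) (hm : m ∣ n) (γ : ringClassField K ι m ≃ₐ[ℚ] ringClassField K ι m),
        γ ∈ ringClassGal ι m → ∀ v : HeightOneSpectrum (𝓞 K),
          ¬ (W.baseChange K).HasGoodReductionAt v →
          n' • pointsMap (W.baseChange K) (v.adicCompletion K)
              ((d m hm).toGeomPoints (pointGalHom W (ringClassField K ι m) γ (d m hm).y)) ∈
            E0Receptacle (W.baseChange K) v ∧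
          ∀ (ℓ : ℕ) (hℓ : ℓ ∈ m.primeFactors)
            (hle : ringClassField K ι (m / ℓ) ≤ ringClassField K ι m),
            n' • pointsMap (W.baseChange K) (v.adicCompletion K)
                ((d m hm).toGeomPoints (pointGalHom W (ringClassField K ι m) γ
                  (WeierstrassCurve.Affine.Point.map (W' := W)
                    ((RingClassField.inclusion ι hle).restrictScalars ℚ)
                    (d (m / ℓ) ((Nat.div_dvd_of_dvd (Nat.dvd_of_mem_primeFactors hℓ)).trans hm)).y))) ∈
              E0Receptacle (W.baseChange K) v := by
  have hn0 : n ≠ 0 := Squarefree.ne_zero hn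
  -- a prime of `\bar 𝓞_v` above `𝓂_v`, for every `v`
  have h𝔐 : ∀ v : HeightOneSpectrum (𝓞 K), ∃ 𝔐 : Ideal (v.localAbsIntegers), 𝔐 ∈ v.localPrimesAbove :=
    fun v ↦ v.localPrimesAbove_nonempty
  choose 𝔐 h𝔐 using h𝔐
  -- the Kodaira–Néron exponent `c_v` at every place, prime to `p`
  have hc : ∀ v : HeightOneSpectrum (𝓞 K), ∃ c : ℕ, ¬ p ∣ c ∧
      (¬ (W.baseChange K).HasGoodReductionAt v →
        ∀ Q : localPoints (W.baseChange K) (v.adicCompletion K),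
          (∀ σ ∈ (𝔐 v).inertia (absoluteGaloisGroup (v.adicCompletion K)), σ • Q = Q) →
            c • Q ∈ E0Receptacle (W.baseChange K) v) := by
    intro v
    by_cases hgood : (W.baseChange K).HasGoodReductionAt v
    · exact ⟨1, fun h ↦ hp.one_lt.ne' (Nat.dvd_one.mp h), fun h ↦ absurd hgood h⟩
    have htri : (W.baseChange K).HasGoodReductionAt v ∨
        (W.baseChange K).HasMultiplicativeReductionAt v ∨ (W.baseChange K).HasAdditiveReductionAt v :=
      ((W.baseChange K).localMinimalModel
        v).hasGoodReduction_or_hasMultiplicativeReduction_or_hasAdditiveReduction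
        (R := v.adicCompletionIntegers K)
    rcases htri with h | h | h
    · exact absurd h hgood
    · exact ⟨(W.baseChange K).ordMinimalDiscriminant v, hmult v h, fun _ Q hQ ↦
        ordMinimalDiscriminant_nsmul_mem_E0Receptacle (W.baseChange K) v h (h𝔐 v) hQ⟩
    · rcases hadd v h with hp3 | ⟨hIV, hIVs⟩
      · -- `p ≥ 5`: the exponent `≤ 4` is prime to `p`
        obtain ⟨c, hc0, hc4, hcE⟩ :=
          exists_nsmul_mem_E0Receptacle_le_four (W.baseChange K) v h (h𝔐 v)
        refine ⟨c, fun hpc ↦ ?_, fun _ Q hQ ↦ hcE Q hQ⟩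
        have h1 : p ≤ c := Nat.le_of_dvd hc0 hpc
        have h5 : 5 ≤ p := by
          rcases hp.eq_two_or_odd' with h2 | hodd
          · exact absurd h2 hp2
          · have := hp.two_le; rcases hodd with ⟨k, hk⟩; omega
        omega
      · -- type `∉ {IV, IV*}`: the exponent is prime to `3` (and `≤ 4`, so prime to any `p ≥ 5`)
        obtain ⟨c, hc0, hc4, hc3, hcE⟩ :=
          exists_nsmul_mem_E0Receptacle_not_three_dvd (W.baseChange K) v h hIV hIVs (h𝔐 v)
        refine ⟨c, fun hpc ↦ ?_, fun _ Q hQ ↦ hcE Q hQ⟩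
        have h1 : p ≤ 4 := (Nat.le_of_dvd hc0 hpc).trans hc4
        have h2' : 2 ≤ p := hp.two_le
        interval_cases p
        · exact hp2 rfl
        · exact hc3 hpc
        · exact absurd hp (by decide)
  choose c hcp hcE using hc
  -- `n' = ∏_{v bad} c_v`
  have hfin : ((W.baseChange K).badPlaces (𝓞 K)).Finite := (W.baseChange K).finite_badPlaces_holds (𝓞 K)
  refine ⟨((∏ u ∈ hfin.toFinset, c u : ℕ) : ℤ), ?_, ?_⟩
  · -- prime to `p^M`
    rw [Nat.isCoprime_iff_coprime]
    exact Nat.Coprime.pow_left M (Nat.Coprime.prod_right fun v _ ↦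
      (Nat.Prime.coprime_iff_not_dvd hp).mpr (hcp v))
  -- the clause, for every point of `E(K[m]) ⊆ E(K̄_v)`
  have key : ∀ (v : HeightOneSpectrum (𝓞 K)), ¬ (W.baseChange K).HasGoodReductionAt v →
      ∀ (m : ℕ) (hm : m ∣ n) (P : (W.baseChange (ringClassField K ι m)).toAffine.Point),
        ((∏ u ∈ hfin.toFinset, c u : ℕ) : ℤ) •
            pointsMap (W.baseChange K) (v.adicCompletion K) ((d m hm).toGeomPoints P) ∈
          E0Receptacle (W.baseChange K) v := by
    intro v hv m hm P
    have hm0 : m ≠ 0 := ne_zero_of_dvd_ne_zero hn0 hm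
    have hmv : ((m : ℕ) : 𝓞 K) ∉ v.asIdeal :=
      natCast_not_mem_of_not_hasGoodReductionAt Dt hn (fun q hq ↦ (hKol q hq).1) hv hm
    have hfix : ∀ σ ∈ (𝔐 v).inertia (absoluteGaloisGroup (v.adicCompletion K)),
        σ • pointsMap (W.baseChange K) (v.adicCompletion K) ((d m hm).toGeomPoints P) =
          pointsMap (W.baseChange K) (v.adicCompletion K) ((d m hm).toGeomPoints P) :=
      fun σ hσ ↦ smul_pointsMap_toGeomPoints_eq_of_mem_localInertia hK ι hm0 (d m hm) hmv (h𝔐 v) hσ P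
    have hcv := hcE v hv _ hfix
    have hvS : v ∈ hfin.toFinset := hfin.mem_toFinset.mpr ((mem_badPlaces_iff _ v).mpr hv)
    exact zsmul_mem_of_nsmul_mem_of_dvd _ hcv
      (Int.natCast_dvd_natCast.mpr (Finset.dvd_prod_of_mem c hvS))
  intro m hm γ _ v hv
  exact ⟨key v hv m hm _, fun ℓ hℓ hle ↦ key v hv m hm _⟩

/-- **The same at the cell's prime `p = 3`** (x11b3-lead GEN 23, `WAKE-T1.md` LEAD DEAL #24,
REQUEST): `hGZ_of_kodairaNeron` specialised to `p := 3`, so that the x11b3 reading at `3` quotes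
ONE theorem with no `p ≠ 3 ∨ …` disjunct: on (KN₃) = {`3 ∤ ord_v(Δ_min(E/K))` at every
multiplicative `v`, and Kodaira type `∉ {IV, IV*}` at every additive `v`} the receptacle clause
`hGZ` ([GZ86, III (3.1)] as Gross 1991 p. 245 uses it) holds at `p = 3` for ANY family of
Kolyvagin–Heegner data — a specialisation term, nothing else; [GZ86 III (3.1)] stays cite-only off
(KN₃); nothing booked; no mark. [cite: GrossLMS1991, Prop. 6.2 (1) and its proof]
[cite: SilvermanAEC2009, Thm. VII.6.1, Cor. VII.6.2] -/
theorem hGZ_of_kodairaNeron_three [NeZero N] [W.IsElliptic]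
    (hK : IsImaginaryQuadratic K) (ι : K →+* ℂ) (Dt : ModularParametrizationData W N) {β : ℤ}
    {M : ℕ} {n : ℕ} (hn : Squarefree n)
    (hKol : ∀ q ∈ n.primeFactors, IsKolyvaginPrime N W K 3 q ∧ FrobEqFrobInfty W K (3 ^ M) q)
    (d : (m : ℕ) → m ∣ n → KolyvaginHeegnerData Dt β ι m)
    (hmult3 : ∀ v : HeightOneSpectrum (𝓞 K), (W.baseChange K).HasMultiplicativeReductionAt v →
      ¬ 3 ∣ (W.baseChange K).ordMinimalDiscriminant v)
    (hadd3 : ∀ v : HeightOneSpectrum (𝓞 K), (W.baseChange K).HasAdditiveReductionAt v →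
      (W.baseChange K).kodairaSymbolAt v ≠ KodairaSymbol.IV ∧
        (W.baseChange K).kodairaSymbolAt v ≠ KodairaSymbol.IVstar) :
    ∃ n' : ℤ, IsCoprime ((3 ^ M : ℕ) : ℤ) n' ∧
      ∀ (m : ℕ) (hm : m ∣ n) (γ : ringClassField K ι m ≃ₐ[ℚ] ringClassField K ι m),
        γ ∈ ringClassGal ι m → ∀ v : HeightOneSpectrum (𝓞 K),
          ¬ (W.baseChange K).HasGoodReductionAt v →
          n' • pointsMap (W.baseChange K) (v.adicCompletion K)
              ((d m hm).toGeomPoints (pointGalHom W (ringClassField K ι m) γ (d m hm).y)) ∈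
            E0Receptacle (W.baseChange K) v ∧
          ∀ (ℓ : ℕ) (hℓ : ℓ ∈ m.primeFactors)
            (hle : ringClassField K ι (m / ℓ) ≤ ringClassField K ι m),
            n' • pointsMap (W.baseChange K) (v.adicCompletion K)
                ((d m hm).toGeomPoints (pointGalHom W (ringClassField K ι m) γ
                  (WeierstrassCurve.Affine.Point.map (W' := W)
                    ((RingClassField.inclusion ι hle).restrictScalars ℚ)
                    (d (m / ℓ) ((Nat.div_dvd_of_dvd (Nat.dvd_of_mem_primeFactors hℓ)).trans hm)).y))) ∈
              E0Receptacle (W.baseChange K) v :=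
  hGZ_of_kodairaNeron hK ι Dt Nat.prime_three (by decide) hn hKol d hmult3
    (fun v h ↦ Or.inr (hadd3 v h))

end Summit.BirchSwinnertonDyer.Rank1Residual.X11b.KolyvaginHloc

end
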